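import Summits.BirchSwinnertonDyer.BirchSwinnertonDyer.Theorems.Rank2Observatory2DescZ2RowKit
import HarnessLib

/-!
# BirchSwinnertonDyer — rank ≥ 2 observatory: refined casework of the `μ_θ` descent at a split odd prime (ℤ/2-torsion rows)

HONEST FRAMING: per-curve certified theorems and census instruments; no claim on BSD in rank ≥ 2.

Generic piece of the successor instrument KERNEL-2DESC-Z2 (spec
`code/b2b-bsdr2-cert-3/kernel-2desc-z2/README-Z2.md`). The casework `…Z2OddCase.classes_point_cases`
lists, for a rational point `x = n/d₀²` of `y² = x³ + Ax² + Bx`, the pair of classes of `n − d₀²θ`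
at the two primes over a split odd `ℓ` as one of three shapes (A), (B), (C) computed from residues.
Two of those shapes are COARSER than the local image, and on the first ℤ/2-torsion row (`392190n1`)
the coarse necessary sets do not cut the cover count below `2^(r+2)`. This file adds the two missing
constraints, both elementary:

* (B′) `caseB_sqb_eq_zero`: if `ℓ ∣ d₀` then `m² ≡ n³ (mod ℓ)` forces `n` to be a square mod `ℓ`,
  so shape (B) is the trivial pair only;
* (C′) `bitsAt_point_caseC_lt` / `bitsAt_point_caseC_gt`: if `ℓ ∣ n`, `n = ℓ^v n₀`, and `−θ` is
  presented at the prime `d` as `π^k·β` (`res β ≠ 0`), then for `v < k` the class of `n − eθ` is read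
  off DIRECTLY as `(v, v·c + sqb n₀)` and for `k < v` it equals the class of `−θ`; comparing with the
  relation-derived value `clsC` of shape (C) constrains the parameters `(v, n₀, d₀)`.

`oddClauseR_sound` is `…Z2RowKit.oddClause_sound` with the refined hypotheses: `hNB` is the single
membership of the trivial pair, and `hNC` quantifies over a BOUNDED level `v < k₁ + k₂ + 3` (the
generic proof reduces any level to that range keeping parity and regime) with the four regime
implications as decidable side conditions — per row still one `decide`.
Sorry-free; axioms `propext`, `Classical.choice`, `Quot.sound`.
[cite: Cassels1991LecturesEllipticCurves, §15]
-/

-- single-conjunct summit: `Summit.BirchSwinnertonDyer.BirchSwinnertonDyer.…` repeats the name by design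
set_option linter.dupNamespace false

noncomputable section

open scoped NumberField

namespace Summit.BirchSwinnertonDyer.BirchSwinnertonDyer.Rank2Observatory.TwoDescZ2

/-! ## The two refinements, over a general domain -/

section Generic

variable {R : Type*} [CommRing R] [CharZero R] [IsDomain R] [WfDvdMonoid R] {ℓ : ℕ} [Fact ℓ.Prime]
variable {d : SplitPrime R ℓ} {θ : R} {A B : ℤ}

/-- `sqb` vanishes on squares. [folklore] -/
theorem sqb_eq_zero_of_isSquare {c : ZMod ℓ} (h : IsSquare c) : sqb c = 0 := by
  rw [← qrOf_eq_sqb]; exact (qrOf_eq_zero_iff c).mpr h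

/-- (B′) If `ℓ ∣ d₀` (so `e = d₀² ≡ 0`) then `m² = n(n² + A n e + B e²) ≡ n³ (mod ℓ)`, hence `n` is a
square mod `ℓ`. [folklore] -/
theorem caseB_sqb_eq_zero {n e m d₀ : ℤ} (he : e = d₀ ^ 2)
    (hE : m ^ 2 = n * (n ^ 2 + A * n * e + B * e ^ 2)) (hn : (n : ZMod ℓ) ≠ 0)
    (hd₀ : (d₀ : ZMod ℓ) = 0) : sqb (n : ZMod ℓ) = 0 := by
  apply sqb_eq_zero_of_isSquare
  have he0 : (e : ZMod ℓ) = 0 := by rw [he]; push_cast; rw [hd₀]; ring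
  have h3 : ((m : ZMod ℓ)) ^ 2 = (n : ZMod ℓ) ^ 3 := by
    have h := congrArg (fun z : ℤ => (z : ZMod ℓ)) hE
    simp only [Int.cast_pow, Int.cast_mul, Int.cast_add] at h
    rw [h, he0]; ring
  refine ⟨(m : ZMod ℓ) * (n : ZMod ℓ)⁻¹, ?_⟩
  have h4 : (m : ZMod ℓ) * (n : ZMod ℓ)⁻¹ * ((m : ZMod ℓ) * (n : ZMod ℓ)⁻¹) =
      (m : ZMod ℓ) ^ 2 * ((n : ZMod ℓ)⁻¹) ^ 2 := by ring
  rw [h4, h3, show (n : ZMod ℓ) ^ 3 * ((n : ZMod ℓ)⁻¹) ^ 2 =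
      (n : ZMod ℓ) * ((n : ZMod ℓ) * (n : ZMod ℓ)⁻¹) ^ 2 by ring, mul_inv_cancel₀ hn, one_pow, mul_one]

/-- (C′, regime `v < k`) With `−θ = π^k β` and `n = ℓ^v n₀`, `ℓ ∤ n₀`, `v < k`:
`n − eθ = π^v (π'^v n₀ + e π^(k−v) β)` has residue `res(π')^v n₀ ≠ 0`, so its class is read off
directly: `(v, v·qrOf(res π') + qrOf n₀)`. [folklore] -/
theorem bitsAt_point_caseC_lt {k : ℕ} {β : R} (hθp : -θ = d.π ^ k * β)
    {n n₀ e : ℤ} {v : ℕ} (hv : n = (ℓ : ℤ) ^ v * n₀) (hn₀ : ¬ (ℓ : ℤ) ∣ n₀) (hlt : v < k) :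
    bitsAt d ((n : R) - (e : R) * θ) =
      ((v : ZMod 2), (v : ZMod 2) * qrOf (d.res d.π') + qrOf (n₀ : ZMod ℓ)) := by
  have hn₀' : (n₀ : ZMod ℓ) ≠ 0 := fun h => hn₀ ((ZMod.intCast_zmod_eq_zero_iff_dvd n₀ ℓ).mp h)
  obtain ⟨hp1, hp2, hp3⟩ := pres_intCast (d := d) (R := R) hv hn₀
  obtain ⟨j, hj⟩ := Nat.exists_eq_add_of_lt hlt
  subst hj
  have hα : (n : R) - (e : R) * θ =
      d.π ^ v * (d.π' ^ v * (n₀ : R) + (e : R) * d.π ^ (j + 1) * β) := by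
    have h1 : (e : R) * θ = -((e : R) * (d.π ^ (v + j + 1) * β)) := by rw [← hθp]; ring
    rw [h1, hp1, show v + j + 1 = v + (j + 1) by omega, pow_add]; ring
  have hres : d.res (d.π' ^ v * (n₀ : R) + (e : R) * d.π ^ (j + 1) * β) =
      d.res d.π' ^ v * (n₀ : ZMod ℓ) := by
    rw [map_add, hp2, map_mul, map_mul, map_pow, d.hπ, zero_pow (by omega), mul_zero, zero_mul,
      add_zero]
  rw [bitsAt_eq hα (by rw [hres]; exact hp3), hres, qrOf_mul (pow_ne_zero _ d.hπ') hn₀',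
    qrOf_pow d.hπ']

/-- (C′, regime `k < v`) With `−θ = π^k β`, `res β ≠ 0`, `n = ℓ^v n₀`, `ℓ ∤ n₀ d₀`, `k < v`:
`n − eθ = π^k (π^(v−k) π'^v n₀ + e β)` has residue `e·res β ≠ 0`, so its class is that of `−θ`
(`e = d₀²` is a square). [folklore] -/
theorem bitsAt_point_caseC_gt {k : ℕ} {β : R} (hθp : -θ = d.π ^ k * β) (hβ : d.res β ≠ 0)
    {n n₀ e d₀ : ℤ} {v : ℕ} (hv : n = (ℓ : ℤ) ^ v * n₀) (hn₀ : ¬ (ℓ : ℤ) ∣ n₀) (he : e = d₀ ^ 2)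
    (hd₀ : (d₀ : ZMod ℓ) ≠ 0) (hgt : k < v) :
    bitsAt d ((n : R) - (e : R) * θ) = bitsAt d (-θ) := by
  obtain ⟨hp1, -, -⟩ := pres_intCast (d := d) (R := R) hv hn₀
  obtain ⟨j, hj⟩ := Nat.exists_eq_add_of_lt hgt
  subst hj
  have hα : (n : R) - (e : R) * θ =
      d.π ^ k * (d.π ^ (j + 1) * (d.π' ^ (k + j + 1) * (n₀ : R)) + (e : R) * β) := by
    have h1 : (e : R) * θ = -((e : R) * (d.π ^ k * β)) := by rw [← hθp]; ring
    rw [h1, hp1, show k + j + 1 = k + (j + 1) by omega, pow_add]; ring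
  have he0 : (e : ZMod ℓ) ≠ 0 := by rw [he]; push_cast; exact pow_ne_zero _ hd₀
  have hres : d.res (d.π ^ (j + 1) * (d.π' ^ (k + j + 1) * (n₀ : R)) + (e : R) * β) =
      (e : ZMod ℓ) * d.res β := by
    rw [map_add, map_mul (f := d.res) (d.π ^ (j + 1)), map_pow, d.hπ, zero_pow (by omega), zero_mul,
      zero_add, map_mul, map_intCast]
  rw [bitsAt_eq hα (by rw [hres]; exact mul_ne_zero he0 hβ), bitsAt_eq hθp hβ, hres, qrOf_mul he0 hβ]
  have hesq : qrOf (e : ZMod ℓ) = 0 := by rw [he]; push_cast; exact qrOf_sq _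
  rw [hesq, zero_add]

/-- Reduction of an arbitrary level `v ≥ 1` to the bounded range `v' < k₁ + k₂ + 3`, keeping parity
and the regime relative to `k₁`, `k₂`. [folklore] -/
theorem exists_level_rep (k₁ k₂ : ℕ) {v : ℕ} (hv1 : 1 ≤ v) :
    ∃ v' : ℕ, v' < k₁ + k₂ + 3 ∧ 1 ≤ v' ∧ v' % 2 = v % 2 ∧ (v < k₁ ↔ v' < k₁) ∧ (k₁ < v ↔ k₁ < v') ∧
      (v < k₂ ↔ v' < k₂) ∧ (k₂ < v ↔ k₂ < v') := by
  by_cases hv : v ≤ k₁ + k₂ + 2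
  · exact ⟨v, by omega, hv1, rfl, Iff.rfl, Iff.rfl, Iff.rfl, Iff.rfl⟩
  · by_cases hpar : v % 2 = (k₁ + k₂ + 2) % 2
    · exact ⟨k₁ + k₂ + 2, by omega, by omega, hpar.symm, by omega, by omega, by omega, by omega⟩
    · exact ⟨k₁ + k₂ + 1, by omega, by omega, by omega, by omega, by omega, by omega, by omega⟩

end Generic

/-! ## Soundness of the refined odd clause -/

section Sound

variable {K : Type*} [Field K] [NumberField K]

/-- **Soundness of the refined odd-prime clause.** As `…Z2RowKit.oddClause_sound`, with shape (B)
reduced to the trivial pair (B′) and shape (C) carrying the regime constraints (C′) relative to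
certified presentations `−θ = πᵢ^kᵢ βᵢ` at both primes; the level is bounded by `k₁ + k₂ + 3` so
that the row obligation `hNC` is a `decide`. [cite: Cassels1991LecturesEllipticCurves, §15] -/
theorem oddClauseR_sound {ℓ : ℕ} [Fact ℓ.Prime] (d₁ d₂ : SplitPrime (𝓞 K) ℓ) {A B : ℤ} {θ : 𝓞 K}
    (hq : θ ^ 2 + (A : 𝓞 K) * θ + (B : 𝓞 K) = 0) (hθ0 : θ ≠ 0)
    (hθQ : ∀ q : ℚ, algebraMap ℚ K q ≠ algebraMap (𝓞 K) K θ)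
    {t₁ t₂ : ZMod ℓ} (ht₁ : d₁.res θ = t₁) (ht₂ : d₂.res θ = t₂)
    (hs₁ : (A : ZMod ℓ) + 2 * t₁ ≠ 0) (hs₂ : (A : ZMod ℓ) + 2 * t₂ ≠ 0)
    {c₁ c₂ : ZMod 2} (hc₁ : qrOf (d₁.res d₁.π') = c₁) (hc₂ : qrOf (d₂.res d₂.π') = c₂)
    {k₁ k₂ : ℕ} {β₁ β₂ : 𝓞 K} (hθp₁ : -θ = d₁.π ^ k₁ * β₁) (hβ₁ : d₁.res β₁ ≠ 0)
    (hθp₂ : -θ = d₂.π ^ k₂ * β₂) (hβ₂ : d₂.res β₂ ≠ 0)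
    {nθ₁ nθ₂ : ZMod 2 × ZMod 2} (hnθ₁ : bitsAt d₁ (-θ) = nθ₁) (hnθ₂ : bitsAt d₂ (-θ) = nθ₂)
    {m s : ℕ} {Wu : Fin m → (𝓞 K)ˣ} {G : Fin s → 𝓞 K} (hG0 : ∀ j, G j ≠ 0)
    {bu₁ bu₂ : Fin m → ZMod 2 × ZMod 2} {bg₁ bg₂ : Fin s → ZMod 2 × ZMod 2}
    (hbu₁ : ∀ i, bitsAt d₁ (Wu i : 𝓞 K) = bu₁ i) (hbu₂ : ∀ i, bitsAt d₂ (Wu i : 𝓞 K) = bu₂ i)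
    (hbg₁ : ∀ j, bitsAt d₁ (G j) = bg₁ j) (hbg₂ : ∀ j, bitsAt d₂ (G j) = bg₂ j)
    (N : Finset ((ZMod 2 × ZMod 2) × (ZMod 2 × ZMod 2)))
    (hNA : ∀ r s : ZMod ℓ, r ≠ 0 → s ≠ 0 → (clsA A t₁ r s, clsA A t₂ r s) ∈ N)
    (hNB : (((0 : ZMod 2), (0 : ZMod 2)), ((0 : ZMod 2), (0 : ZMod 2))) ∈ N)
    (hNC : ∀ v : ℕ, v < k₁ + k₂ + 3 → 1 ≤ v → ∀ r s : ZMod ℓ, r ≠ 0 → s ≠ 0 →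
      (v < k₁ → clsC A t₁ c₁ (v : ZMod 2) r s = ((v : ZMod 2), (v : ZMod 2) * c₁ + sqb r)) →
      (k₁ < v → clsC A t₁ c₁ (v : ZMod 2) r s = nθ₁) →
      (v < k₂ → clsC A t₂ c₂ (v : ZMod 2) r s = ((v : ZMod 2), (v : ZMod 2) * c₂ + sqb r)) →
      (k₂ < v → clsC A t₂ c₂ (v : ZMod 2) r s = nθ₂) →
      (clsC A t₁ c₁ (v : ZMod 2) r s, clsC A t₂ c₂ (v : ZMod 2) r s) ∈ N)
    (hN0 : (nθ₁, nθ₂) ∈ N)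
    {x y : ℚ} (hE : y ^ 2 = x ^ 3 + A * x ^ 2 + B * x) (T : Finset (Fin m)) (U : Finset (Fin s))
    (hsq : IsSquare ((algebraMap ℚ K x - algebraMap (𝓞 K) K θ) *
      (∏ i ∈ T, algebraMap (𝓞 K) K (Wu i : 𝓞 K)) * ∏ j ∈ U, algebraMap (𝓞 K) K (G j))) :
    (∑ i ∈ T, bu₁ i + ∑ j ∈ U, bg₁ j, ∑ i ∈ T, bu₂ i + ∑ j ∈ U, bg₂ j) ∈ N := by
  set wTU : 𝓞 K := (∏ i ∈ T, (Wu i : 𝓞 K)) * ∏ j ∈ U, G j with hw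
  have hw0 : wTU ≠ 0 := mul_ne_zero (Finset.prod_ne_zero_iff.mpr fun i _ => (Wu i).ne_zero)
    (Finset.prod_ne_zero_iff.mpr fun j _ => hG0 j)
  have hsq' : IsSquare ((algebraMap ℚ K x - algebraMap (𝓞 K) K θ) * algebraMap (𝓞 K) K wTU) := by
    rw [hw, map_mul, map_prod, map_prod, ← mul_assoc]; exact hsq
  obtain ⟨n, d₀, mm, hd₀, hcop, hx, hEZ⟩ := exists_integral_form hE
  have hx' : x = (n : ℚ) / ((d₀ ^ 2 : ℤ) : ℚ) := by rw [hx, Int.cast_pow]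
  have hα : (n : 𝓞 K) - ((d₀ ^ 2 : ℤ) : 𝓞 K) * θ ≠ 0 := sub_ne_zero_of_not_rat hθQ (pow_ne_zero 2 hd₀)
  have hT₁ := bitsAt_point_eq_of_isSquare d₁ (rfl : (d₀ ^ 2 : ℤ) = d₀ ^ 2) hd₀ hx' hα hw0 hsq'
  have hT₂ := bitsAt_point_eq_of_isSquare d₂ (rfl : (d₀ ^ 2 : ℤ) = d₀ ^ 2) hd₀ hx' hα hw0 hsq'
  rw [← bitsAt_w_eq d₁ hG0 hbu₁ hbg₁ T U, ← bitsAt_w_eq d₂ hG0 hbu₂ hbg₂ T U, ← hT₁, ← hT₂]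
  by_cases hn : n = 0
  · -- the torsion point `x = 0`: the class of `−θ`
    have hd₀R : ((d₀ : 𝓞 K)) ≠ 0 := by exact_mod_cast hd₀
    have hneg : (n : 𝓞 K) - ((d₀ ^ 2 : ℤ) : 𝓞 K) * θ = (-θ) * (d₀ : 𝓞 K) ^ 2 := by
      rw [hn]; push_cast; ring
    rw [hneg, bitsAt_mul (neg_ne_zero.mpr hθ0) (pow_ne_zero 2 hd₀R),
      bitsAt_mul (neg_ne_zero.mpr hθ0) (pow_ne_zero 2 hd₀R), bitsAt_sq hd₀R, bitsAt_sq hd₀R,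
      add_zero, add_zero, hnθ₁, hnθ₂]
    exact hN0
  · have hℓp : Prime (ℓ : ℤ) := Nat.prime_iff_prime_int.mp (Fact.out : ℓ.Prime)
    have hcop' : ¬ ((ℓ : ℤ) ∣ n ∧ (ℓ : ℤ) ∣ d₀) := not_dvd_and_dvd_of_isCoprime hcop hℓp.not_unit
    by_cases hln : (ℓ : ℤ) ∣ n
    · -- case (C), refined
      have hd₀n : ¬ (ℓ : ℤ) ∣ d₀ := fun h => hcop' ⟨hln, h⟩
      have hd₀' : (d₀ : ZMod ℓ) ≠ 0 := fun h => hd₀n ((ZMod.intCast_zmod_eq_zero_iff_dvd d₀ ℓ).mp h)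
      obtain ⟨v, n₀, hn₀, hv⟩ := WfDvdMonoid.max_power_factor' hn hℓp.not_unit
      have hv1 : 1 ≤ v := by
        by_contra h0
        have : v = 0 := by omega
        rw [this, pow_zero, one_mul] at hv
        exact hn₀ (hv ▸ hln)
      have hn₀' : (n₀ : ZMod ℓ) ≠ 0 := fun h => hn₀ ((ZMod.intCast_zmod_eq_zero_iff_dvd n₀ ℓ).mp h)
      have hC₁ := bitsAt_point_caseC hq ht₁ hs₁ hc₁ hv hv1 hn₀ rfl hEZ hd₀' hα
      have hC₂ := bitsAt_point_caseC hq ht₂ hs₂ hc₂ hv hv1 hn₀ rfl hEZ hd₀' hα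
      obtain ⟨v', hv'b, hv'1, hmod, i1, i2, i3, i4⟩ := exists_level_rep k₁ k₂ hv1
      have hvv : (v' : ZMod 2) = (v : ZMod 2) := (ZMod.natCast_eq_natCast_iff' v' v 2).mpr hmod
      rw [hC₁, hC₂, ← hvv]
      refine hNC v' hv'b hv'1 _ _ hn₀' hd₀' ?_ ?_ ?_ ?_
      · intro h
        rw [hvv, ← hC₁, bitsAt_point_caseC_lt hθp₁ hv hn₀ (i1.mpr h), hc₁, qrOf_eq_sqb]
      · intro h
        rw [hvv, ← hC₁, bitsAt_point_caseC_gt hθp₁ hβ₁ hv hn₀ rfl hd₀' (i2.mpr h), hnθ₁]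
      · intro h
        rw [hvv, ← hC₂, bitsAt_point_caseC_lt hθp₂ hv hn₀ (i3.mpr h), hc₂, qrOf_eq_sqb]
      · intro h
        rw [hvv, ← hC₂, bitsAt_point_caseC_gt hθp₂ hβ₂ hv hn₀ rfl hd₀' (i4.mpr h), hnθ₂]
    · have hn' : (n : ZMod ℓ) ≠ 0 := fun h => hln ((ZMod.intCast_zmod_eq_zero_iff_dvd n ℓ).mp h)
      by_cases hld : (ℓ : ℤ) ∣ d₀
      · -- case (B), refined: `n` is a square mod `ℓ`
        have hd₀' : (d₀ : ZMod ℓ) = 0 := (ZMod.intCast_zmod_eq_zero_iff_dvd d₀ ℓ).mpr hld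
        rw [bitsAt_point_caseB ht₁ rfl hn' hd₀', bitsAt_point_caseB ht₂ rfl hn' hd₀',
          caseB_sqb_eq_zero (A := A) (B := B) rfl hEZ hn' hd₀']
        exact hNB
      · -- case (A)
        have hd₀' : (d₀ : ZMod ℓ) ≠ 0 := fun h => hld ((ZMod.intCast_zmod_eq_zero_iff_dvd d₀ ℓ).mp h)
        rw [bitsAt_point_caseA hq ht₁ hs₁ rfl hEZ hn' hd₀' hα, bitsAt_point_caseA hq ht₂ hs₂ rfl hEZ hn' hd₀' hα]
        exact hNA _ _ hn' hd₀'

end Sound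

end Summit.BirchSwinnertonDyer.BirchSwinnertonDyer.Rank2Observatory.TwoDescZ2

end
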